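import Literature.AlgebraicGeometry.Modules.LocalFrames
import HarnessLib

/-!
# `𝓗om_{𝒪_X}(𝒪_X, F) ≅ F`, naturally in `F`

For an `𝒪_X`-module `F` on a scheme `X`, evaluation at the unit section `1 ∈ Γ(X, U)` identifies the
internal Hom out of the structure sheaf with `F`:

* `unitEval F : 𝓗om(𝒪_X, F) ⟶ F` — on sections over `U`, `φ ↦ φ_U(1)` (`unitEval_app_apply`);
* `unitSmul F : F ⟶ 𝓗om(𝒪_X, F)` — `s ↦ (r ↦ r • s|)` (the tree's `smulSection`; `unitSmul_app_apply`);
* `unitSheafHomIso F : 𝓗om(𝒪_X, F) ≅ F` — the two are inverse `𝒪_X`-linear isomorphisms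
  (`unitEval_unitSmul`, `unitSmul_unitEval`);
* `unitSheafHomIso_naturality` ∕ `unitEval_naturality` ∕ `unitSmul_naturality` — natural in `F` along
  the covariant functoriality `sheafHomMap 𝒪_X f` of `Modules/SheafHomFunctor.lean`.

This is the `𝒪_X`-module form of «`Hom_R(R, M) = M`»; written for the venture `HSemireg` (cell
`pub-hsemireg`, seat s4-prove-1 g28, 2026-08-28; piece (c2) of the contraction construction priced on
the cell bus, director-hodge R13.58): it is the identification that turns the class of
`0 → 𝓗om(𝒪_X, F) → 𝓗om(𝒦, F) → 𝓗om(𝒯, F) → 0` into a class in `Ext¹(𝓗om(𝒯, F), F)` — NOT done here.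
Everything is proved; no named fact, no instance, no notation.

## References

* The Stacks project, Tag 01CM (Modules: internal Hom; `𝓗om_{𝒪_X}(𝒪_X, F) = F`). [StacksProject]
* R. Hartshorne, *Algebraic Geometry*, GTM 52 (1977), II.5 (p. 109). [Hartshorne1977]
-/

noncomputable section

open CategoryTheory AlgebraicGeometry Opposite TopologicalSpace Limits

namespace Literature.AlgebraicGeometry.Modules

open Literature.AlgebraicGeometry.Motives

universe u

variable {X : Scheme.{u}} (F : X.Modules) {U V W : X.Opens}

/-! ### Sections of the structure sheaf: the unit section restricts to the unit section -/

/-- The restriction maps of `𝒪_X` (as an `𝒪_X`-module) send `1` to `1`. [folklore] -/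
private lemma unit_presheaf_map_one (k : W ⟶ U) :
    (unitModule X).presheaf.map k.op (1 : Γ(X, U)) = (1 : Γ(X, W)) :=
  map_one (X.presheaf.map k.op).hom

/-- A morphism `φ : 𝒪_X|_U → F|_U` is determined by its value at `1`: `φ_W(r) = r • φ_U(1)|_W`.
[cite: StacksProject, Tag 01CM] -/
theorem appLE_eq_smul_appLE_one (φ : (unitModule X).over U ⟶ F.over U) (k : W ⟶ U) (r : Γ(X, W)) :
    appLE φ k r = r • F.presheaf.map k.op (appLE φ (𝟙 U) (1 : Γ(X, U))) := by
  rw [← appLE_map φ (𝟙 U) k, unit_presheaf_map_one, ← appLE_smul_right,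
    appLE_congr_hom φ (k ≫ 𝟙 U) k]
  congr 1
  exact (mul_one r).symm

/-! ### `smulSection` calculus on a general scheme (the library's copies live over `Spec`-schemes) -/

/-- `smulSection` is additive in the section. [folklore] -/
private lemma smulSection_add' (s t : Γ(F, U)) :
    (smulSection (s + t) : (unitModule X).over U ⟶ F.over U) = smulSection s + smulSection t :=
  hom_ext_of_appLE fun W k (r : Γ(X, W)) => by
    rw [appLE_add, appLE_smulSection, appLE_smulSection, appLE_smulSection, map_add, smul_add]

/-- `smulSection 0 = 0`. [folklore] -/
private lemma smulSection_zero' :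
    (smulSection (0 : Γ(F, U)) : (unitModule X).over U ⟶ F.over U) = 0 :=
  hom_ext_of_appLE fun W k (r : Γ(X, W)) => by
    rw [appLE_zero, appLE_smulSection, map_zero, smul_zero]

/-- `smulSection` is `𝒪(U)`-linear in the section. [folklore] -/
private lemma smulSection_smul' (a : Γ(X, U)) (s : Γ(F, U)) :
    (smulSection (a • s) : (unitModule X).over U ⟶ F.over U) = a • smulSection s :=
  hom_ext_of_appLE fun W k (r : Γ(X, W)) => by
    rw [appLE_smul, appLE_smulSection, appLE_smulSection, Scheme.Modules.map_smul, smul_smul,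
      smul_smul, mul_comm]

/-- `smulSection` commutes with restriction. [folklore] -/
private lemma restrictHom_smulSection' (i : V ⟶ U) (s : Γ(F, U)) :
    restrictHom i (smulSection s : (unitModule X).over U ⟶ F.over U) =
      smulSection (F.presheaf.map i.op s) :=
  hom_ext_of_appLE fun W k (r : Γ(X, W)) => by
    rw [appLE_restrictHom, appLE_smulSection, appLE_smulSection, presheaf_map_map]

/-! ### Evaluation at `1` and multiplication by a section -/

/-- **Evaluation at the unit section**: `𝓗om(𝒪_X, F) ⟶ F`, `φ ↦ φ_U(1)` on sections over `U`.
[cite: StacksProject, Tag 01CM] -/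
def unitEval : sheafHom (unitModule X) F ⟶ F where
  val := PresheafOfModules.homMk
    { app := fun U => AddCommGrpCat.ofHom
        { toFun := fun φ : (unitModule X).over U.unop ⟶ F.over U.unop =>
            appLE φ (𝟙 U.unop) (1 : Γ(X, U.unop))
          map_zero' := appLE_zero _ _
          map_add' := fun φ ψ => appLE_add φ ψ _ _ }
      naturality := fun {U V} i => by
        refine AddCommGrpCat.ext fun (φ : (unitModule X).over U.unop ⟶ F.over U.unop) => ?_
        change appLE (restrictHom i.unop φ) (𝟙 _) (1 : Γ(X, V.unop)) =
          F.presheaf.map i.unop.op (appLE φ (𝟙 _) (1 : Γ(X, U.unop)))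
        rw [appLE_restrictHom, ← appLE_map, unit_presheaf_map_one]
        exact appLE_congr_hom φ _ _ _ }
    (fun U (a : Γ(X, U.unop)) (φ : (unitModule X).over U.unop ⟶ F.over U.unop) => by
      change appLE (a • φ) (𝟙 _) (1 : Γ(X, U.unop)) = a • appLE φ (𝟙 _) (1 : Γ(X, U.unop))
      rw [appLE_smul, op_id, X.presheaf.map_id]
      rfl)

/-- Sections of `unitEval`: `φ ↦ φ_U(1)`. [cite: StacksProject, Tag 01CM] -/
@[simp]
theorem unitEval_app_apply (U : X.Opens) (φ : (unitModule X).over U ⟶ F.over U) :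
    (unitEval F).app U φ = appLE φ (𝟙 U) (1 : Γ(X, U)) := rfl

/-- **Multiplication by a section**: `F ⟶ 𝓗om(𝒪_X, F)`, `s ↦ (r ↦ r • s|)` on sections over `U`
(the tree's `smulSection`). [cite: StacksProject, Tag 01CM] -/
def unitSmul : F ⟶ sheafHom (unitModule X) F where
  val := PresheafOfModules.homMk
    { app := fun U => AddCommGrpCat.ofHom
        { toFun := fun s : Γ(F, U.unop) => (smulSection s : (unitModule X).over U.unop ⟶ F.over U.unop)
          map_zero' := smulSection_zero' F
          map_add' := fun s t => smulSection_add' F s t }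
      naturality := fun {U V} i => by
        refine AddCommGrpCat.ext fun (s : Γ(F, U.unop)) => ?_
        exact (restrictHom_smulSection' F i.unop s).symm }
    (fun U (a : Γ(X, U.unop)) (s : Γ(F, U.unop)) => smulSection_smul' F a s)

/-- Sections of `unitSmul`: `s ↦ smulSection s`. [cite: StacksProject, Tag 01CM] -/
@[simp]
theorem unitSmul_app_apply (U : X.Opens) (s : Γ(F, U)) :
    (unitSmul F).app U s = (smulSection s : (unitModule X).over U ⟶ F.over U) := rfl

/-- `φ ↦ φ_U(1) ↦ (r ↦ r • φ_U(1)|) = φ`. [cite: StacksProject, Tag 01CM] -/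
theorem unitEval_unitSmul : unitEval F ≫ unitSmul F = 𝟙 _ := by
  refine Scheme.Modules.hom_ext _ _ fun U => AddCommGrpCat.ext
    fun (φ : (unitModule X).over U ⟶ F.over U) => hom_ext_of_appLE fun W k r => ?_
  change appLE (smulSection (appLE φ (𝟙 U) (1 : Γ(X, U)))) k r = appLE φ k r
  rw [appLE_smulSection]
  exact (appLE_eq_smul_appLE_one F φ k r).symm

/-- `s ↦ (r ↦ r • s|) ↦ 1 • s = s`. [cite: StacksProject, Tag 01CM] -/
theorem unitSmul_unitEval : unitSmul F ≫ unitEval F = 𝟙 _ := by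
  refine Scheme.Modules.hom_ext _ _ fun U => AddCommGrpCat.ext fun (s : Γ(F, U)) => ?_
  change appLE (smulSection s) (𝟙 U) (1 : Γ(X, U)) = s
  rw [appLE_smulSection, one_smul, presheaf_map_id]

/-- **`𝓗om_{𝒪_X}(𝒪_X, F) ≅ F`** (evaluation at `1`, inverse multiplication by a section).
[cite: StacksProject, Tag 01CM] -/
def unitSheafHomIso : sheafHom (unitModule X) F ≅ F where
  hom := unitEval F
  inv := unitSmul F
  hom_inv_id := unitEval_unitSmul F
  inv_hom_id := unitSmul_unitEval F

/-- `(unitSheafHomIso F).hom = unitEval F`. [cite: StacksProject, Tag 01CM] -/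
@[simp]
theorem unitSheafHomIso_hom : (unitSheafHomIso F).hom = unitEval F := rfl

/-- `(unitSheafHomIso F).inv = unitSmul F`. [cite: StacksProject, Tag 01CM] -/
@[simp]
theorem unitSheafHomIso_inv : (unitSheafHomIso F).inv = unitSmul F := rfl

/-! ### Naturality in `F` -/

variable {F} {G : X.Modules} (f : F ⟶ G)

/-- **Naturality of evaluation at `1`**: `𝓗om(𝒪_X, f) ≫ ev₁ = ev₁ ≫ f`. [cite: StacksProject, Tag 01CM] -/
theorem unitEval_naturality : sheafHomMap (unitModule X) f ≫ unitEval G = unitEval F ≫ f :=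
  Scheme.Modules.hom_ext _ _ fun U => AddCommGrpCat.ext
    fun (_ : (unitModule X).over U ⟶ F.over U) => rfl

/-- Naturality of multiplication by a section: `f ≫ (s ↦ r • s) = (s ↦ r • s) ≫ 𝓗om(𝒪_X, f)`.
[cite: StacksProject, Tag 01CM] -/
theorem unitSmul_naturality : f ≫ unitSmul G = unitSmul F ≫ sheafHomMap (unitModule X) f := by
  have : IsIso (unitEval F) := (inferInstance : IsIso (unitSheafHomIso F).hom)
  rw [← cancel_epi (unitEval F), ← Category.assoc, ← unitEval_naturality, Category.assoc,
    unitEval_unitSmul, Category.comp_id, ← Category.assoc, unitEval_unitSmul, Category.id_comp]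

/-- **Naturality of `𝓗om_{𝒪_X}(𝒪_X, F) ≅ F`** (as a square of isomorphisms' `hom`s).
[cite: StacksProject, Tag 01CM] -/
theorem unitSheafHomIso_naturality :
    sheafHomMap (unitModule X) f ≫ (unitSheafHomIso G).hom = (unitSheafHomIso F).hom ≫ f :=
  unitEval_naturality f

end Literature.AlgebraicGeometry.Modules

end
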